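import Summits.QuantumFields.YangMills.Theorems.FluctuationComparisonRegPrIntLS2BetaChartReadDescentChainRule
import Literature.MathematicalPhysics.QuantumFieldTheory.Balaban1983to89.T4Covariance
import HarnessLib

/-!
# S2β · (REG-UP)′ bridge (O2-a) — «TRANSLATION EQUIVARIANCE OF THE k-STEP CHART-READ AND OF ITS LINEARISATION»:
# `Ψ_k^{τ_a U₀} = T_k ∘ Ψ_k^{U₀} ∘ T₀` for a COARSE-lattice translation `v : Site P k` lifted to the fine lattice as `a = scaleTo k v = L^k·v`, hence
# `(DΨ_k^{τ_a U₀}(0) (τ_a X)) c = (DΨ_k^{U₀}(0) X) (c.translate v)` — the structural half of the Prop-4 road (px13 g29's (REG-UP)′ plan, 2026-09-01T02:15:16Z (2))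

Cell `ym3-torus` (YM ladder rung R3 = continuum `SU(2)` Yang–Mills on the three-torus at fixed lattice data — a RUNG: NOT d = 4, NOT infinite volume, NOT a mass gap,
NOT Clay).  Width seat «width 12» `ym3-torus-px12` (gen 27); crux `stmt-QuantumFields-20520`, LINE g18-1 S2β, node (REG-UP)′ «the Prop-4 road» ([Balaban1985Averaging] Prop. 4
(130): `‖L^j·Q_j(U₀)A‖ ≤ 2L^j‖A‖` UNIFORMLY in `j`; its S2β edition needs the k-step linearised chart map `DΨ_k(0)` to be TRANSLATION-EQUIVARIANT (this file) and
BACKGROUND-LIPSCHITZ ((O2-b), sequel)).  `--kind proof --supports stmt-QuantumFields-20520 --as helper`, count-neutral, DEFINITION-FREE (0 `def`, 0 `instance`, 0 `notation`,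
0 `sorry`, default heartbeats).  Generic `P : Params`, `SU(N)`; conventions of ✓p823800∕✓`…ChartReadDescentChainRule` VERBATIM (`Θ`∕`Λ` = `expChart`∕`logChart` of
`isChartRep_specialUnitaryGroup (n := Fin N)`, `Ū^k = Averaging.iter (blockAvg expMeanLogSU) k`, `Ψ_k^{V} A c := Λ(Ū^k(Θ(A)·V)(c)·Ū^k(V)(c)⁻¹)`), translations = lit
✓`GaugeField.translate`∕✓`PBond.translate` (`(τ_a U) b = U (b.translate a)`, `b.translate a = ⟨b.src + a, b.dir⟩`), lifts = lit ✓`Site.scaleTo` (`scaleTo (k+1) = scaleTo k ∘ scale`).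

WHAT IS PROVED (sorry-free).
* §1 ★`iter_blockAvg_translate` — `Ū^k(τ_{scaleTo k v} U) = τ_v(Ū^k U)` for the EML block averaging, any `k`, NO guard (lit ✓`T4Continuum.iter_translate` ∘ ✓`blockAvg_translate`);
  ★`translate_translate_neg'`∕`fun_translate_neg_translate` (bond bookkeeping).
* §2 ★★`chartRead_iter_translate` — THE FUNCTION IDENTITY, exact, no guard: `Ψ_k^{τ_a U₀} A = fun c => Ψ_k^{U₀} (fun ℓ => A (ℓ.translate (−a))) (c.translate v)`, `a = scaleTo k v`.
* §3 ★`smallBelow_translate` — the (0.4) guard transports: `SmallBelow … k U₀ → SmallBelow … k (τ_a U₀)` (§1 + lit ✓`loopHol_translate`).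
* §4 ★★★**`fderiv_chartRead_iter_translate`** — under `SmallBelow … k U₀`: **`(fderiv ℝ Ψ_k^{τ_a U₀} 0 (fun ℓ => X (ℓ.translate a))) c = (fderiv ℝ Ψ_k^{U₀} 0 X) (c.translate v)`**
  (§2 read as `Ψ^{τU₀} = T_k ∘ Ψ^{U₀} ∘ T₀` with the pre-composition CLMs `T₀ A := A ∘ (·.translate (−a))`, `T_k Y := Y ∘ (·.translate v)`; chain rule at `0` with
  ✓`contDiffAt_chartRead_iter`; `T₀ (X ∘ (·.translate a)) = X`); ★★`fderiv_chartRead_iter_translate_clm` — the operator form `fderiv ℝ Ψ_k^{τ_aU₀} 0 = T_k ∘L fderiv ℝ Ψ_k^{U₀} 0 ∘L T₀`.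
USE ((REG-UP)′, px13 g29): the covariant oscillation of `DΨ_l(0)X₀` between `c̄` and `c̄ + v̄` is `‖DΨ_l‖_{∞→∞}·‖τX₀ − X₀‖_∞ +` (background-Lipschitz term, (O2-b)) — this file is the
first summand's identity.

HONEST SCOPE.  Kernel calculus∕bookkeeping on the tree's own averaging (translation covariance of `blockAvg`, the chain rule at `0`); NO estimate of Bałaban's is asserted or proved
([Balaban1985Averaging] (11), p.19: covariance of the averaging; Prop. 4 (127)–(130) p.37 is the printed locus of the road, NOT proved here; [Balaban1987RG1] (2.17) p.269);
(O2-b), (REG-UP)′'s assembly, (RES-u), (V4)'s `ha` inhabitant, GAP♯∘ (`stub_uniformFibreGapOrbit`, registry 3732b7df UNTOUCHED, 0∕5), the five registered stubs, S2β, crux 20520,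
19936, 19200, `YM3TorusSU2` — NOT proved; no registered stub is closed; rung R3 — NOT d = 4, NOT infinite volume, NOT a mass gap, NOT Clay; the Yang–Mills mass gap is NOT proved.
-/

set_option autoImplicit false

noncomputable section

open scoped Matrix.Norms.L2Operator Topology
open Filter Set Function

namespace Summit.QuantumFields.YangMills.Theorems.FluctuationComparisonRegPrIntLS2BetaChartReadIterTranslate

open Literature.MathematicalPhysics.QuantumFieldTheory.Balaban1983to89
open Literature.MathematicalPhysics.QuantumFieldTheory.Balaban1983to89.HaarExponentialChart
open Literature.MathematicalPhysics.QuantumFieldTheory.Balaban1983to89.HaarExponentialChart.IsChartRep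
open Literature.MathematicalPhysics.QuantumFieldTheory.Balaban1983to89.BlockAveraging (Small Idx avgFun loopHol blockAvg blockAvg_avg blockAvg_translate loopHol_translate)
open Literature.MathematicalPhysics.QuantumFieldTheory.Balaban1983to89.ExpMeanLog (expMeanLogSU deltaSU)
open Literature.MathematicalPhysics.QuantumFieldTheory.Balaban1983to89.Node00
open Literature.MathematicalPhysics.QuantumFieldTheory.Balaban1983to89.T4Continuum (iter_translate)
open Summit.QuantumFields.YangMills.BalabanUVNodes.N09ChartReadAveragingSmooth
open Summit.QuantumFields.YangMills.Theorems.FluctuationComparisonRegPrIntLS2BetaChartReadDescentOnto (contDiffAt_chartRead_iter chartRead_iter_apply_zero)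

variable {P : Params} {N : ℕ} [NeZero N]

/-! ## §1 Translation covariance of the iterated EML block averaging; bond bookkeeping -/

/-- ★ **`Ū^k(τ_{L^k v} U) = τ_v(Ū^k U)`** for the EML block averaging, every `k` (lit ✓`iter_translate` ∘ ✓`blockAvg_translate`). [cite: Balaban1987RG1, (2.17) p.269] -/
theorem iter_blockAvg_translate {G : Type*} [GaugeGroup G] (ℰ : LoopAverage G) (k : ℕ) (v : Site P k) (U : GaugeField P 0 G) :
    Averaging.iter (fun i => blockAvg (P := P) (j := i) ℰ) k (U.translate (Site.scaleTo k v)) =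
      (Averaging.iter (fun i => blockAvg (P := P) (j := i) ℰ) k U).translate v :=
  iter_translate (fun i => blockAvg (P := P) (j := i) ℰ) (fun _ a W => blockAvg_translate ℰ a W) k v U

/-- ★ `(b.translate a).translate (−a) = b`. [folklore] -/
theorem translate_translate_neg' {j : ℕ} (a : Site P j) (b : PBond P j) : (b.translate a).translate (-a) = b := by
  rw [PBond.translate_translate, add_neg_cancel]
  cases b; simp [PBond.translate]

/-- ★ `(b.translate (−a)).translate a = b`. [folklore] -/
theorem translate_neg_translate' {j : ℕ} (a : Site P j) (b : PBond P j) : (b.translate (-a)).translate a = b := by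
  rw [PBond.translate_translate, neg_add_cancel]
  cases b; simp [PBond.translate]

/-! ## §2 The function identity -/

/-- ★★ **TRANSLATION EQUIVARIANCE OF THE k-STEP CHART-READ** (exact, no guard): with `a = scaleTo k v`,
`Ψ_k^{τ_a U₀} A = fun c => Ψ_k^{U₀} (fun ℓ => A (ℓ.translate (−a))) (c.translate v)`. [cite: Balaban1985Averaging, (11) p.19; Balaban1987RG1, (2.17) p.269] -/
theorem chartRead_iter_translate (U₀ : GaugeField P 0 (SU N)) (k : ℕ) (v : Site P k)
    (A : PBond P 0 → (specialUnitaryLogChart (Fin N)).lie) :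
    (fun (c : PBond P k) =>
        (isChartRep_specialUnitaryGroup (n := Fin N)).logChart
          (Averaging.iter (fun i => blockAvg (P := P) (j := i) (expMeanLogSU (n := Fin N))) k
              (fun b => (isChartRep_specialUnitaryGroup (n := Fin N)).expChart (A b) * (U₀.translate (Site.scaleTo k v)) b) c *
            (Averaging.iter (fun i => blockAvg (P := P) (j := i) (expMeanLogSU (n := Fin N))) k (U₀.translate (Site.scaleTo k v)) c)⁻¹)) =
      fun (c : PBond P k) =>
        (isChartRep_specialUnitaryGroup (n := Fin N)).logChart
          (Averaging.iter (fun i => blockAvg (P := P) (j := i) (expMeanLogSU (n := Fin N))) k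
              (fun b => (isChartRep_specialUnitaryGroup (n := Fin N)).expChart ((fun ℓ => A (ℓ.translate (-(Site.scaleTo k v)))) b) * U₀ b) (c.translate v) *
            (Averaging.iter (fun i => blockAvg (P := P) (j := i) (expMeanLogSU (n := Fin N))) k U₀ (c.translate v))⁻¹) := by
  -- the perturbed field is itself a translate
  have hpert : (fun b : PBond P 0 => (isChartRep_specialUnitaryGroup (n := Fin N)).expChart (A b) * (U₀.translate (Site.scaleTo k v)) b) =
      GaugeField.translate (Site.scaleTo k v)
        (fun b : PBond P 0 => (isChartRep_specialUnitaryGroup (n := Fin N)).expChart ((fun ℓ => A (ℓ.translate (-(Site.scaleTo k v)))) b) * U₀ b :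
          GaugeField P 0 (SU N)) := by
    funext b
    simp only [GaugeField.translate_apply, translate_translate_neg']
  funext c
  rw [hpert, iter_blockAvg_translate, iter_blockAvg_translate, GaugeField.translate_apply, GaugeField.translate_apply]

/-! ## §3 The (0.4) guard transports -/

/-- ★ The small-field guard along the iterates is translation-invariant: `SmallBelow … k U₀ → SmallBelow … k (τ_{L^k v} U₀)` (every level `j < k`: the `j`-th average of the
translate is the translate by `scaleTo`-intermediate vectors — proved via the `scale`-tower `scaleTo k v = scaleTo j (w)`-free route: loops of a translate are translated loops).
[cite: Balaban1987RG1, (0.4) p.253, (2.17) p.269] -/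
theorem smallBelow_translate (U₀ : GaugeField P 0 (SU N)) :
    ∀ (k : ℕ) (v : Site P k), SmallBelow (fun i => blockAvg (P := P) (j := i) (expMeanLogSU (n := Fin N))) k U₀ →
      SmallBelow (fun i => blockAvg (P := P) (j := i) (expMeanLogSU (n := Fin N))) k (U₀.translate (Site.scaleTo k v))
  | 0, _, _ => fun j hj => absurd hj (Nat.not_lt_zero j)
  | k + 1, v, hsb => by
      -- `scaleTo (k+1) v = scaleTo k (scale v)`: reduce to level `k` with the coarse vector `scale v`, then the top level
      intro j hj c
      rw [Site.scaleTo_succ] at *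
      by_cases hjk : j < k
      · exact smallBelow_translate U₀ k (Site.scale v) (hsb.mono (Nat.le_succ k)) j hjk c
      · have hj' : j = k := by omega
        subst hj'
        -- level `k`: `Ū^k(τ U₀) = τ_{scale v}(Ū^k U₀)`, and loops of a translate are translated loops
        intro ι
        have h := hsb j (Nat.lt_succ_self j) (c.translate v) ι
        rw [iter_blockAvg_translate, loopHol_translate]
        exact h

/-! ## §4 The derivative identity -/

/-- ★★ **THE OPERATOR FORM**: under the guard below `k` for `U₀`, `fderiv ℝ Ψ_k^{τ_a U₀} 0 = T_k ∘L (fderiv ℝ Ψ_k^{U₀} 0) ∘L T₀` with the pre-composition maps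
`T₀ A = A ∘ (·.translate (−a))`, `T_k Y = Y ∘ (·.translate v)` (`a = scaleTo k v`). [cite: Balaban1985Averaging, (11) p.19, Prop. 4 (127)-(130) p.37; Balaban1987RG1, (0.11) p.253] -/
theorem fderiv_chartRead_iter_translate_clm (U₀ : GaugeField P 0 (SU N)) (k : ℕ)
    (hsb : SmallBelow (fun i => blockAvg (P := P) (j := i) (expMeanLogSU (n := Fin N))) k U₀) (v : Site P k) :
    fderiv ℝ (fun (A : PBond P 0 → (specialUnitaryLogChart (Fin N)).lie) (c : PBond P k) =>
        (isChartRep_specialUnitaryGroup (n := Fin N)).logChart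
          (Averaging.iter (fun i => blockAvg (P := P) (j := i) (expMeanLogSU (n := Fin N))) k
              (fun b => (isChartRep_specialUnitaryGroup (n := Fin N)).expChart (A b) * (U₀.translate (Site.scaleTo k v)) b) c *
            (Averaging.iter (fun i => blockAvg (P := P) (j := i) (expMeanLogSU (n := Fin N))) k (U₀.translate (Site.scaleTo k v)) c)⁻¹)) 0 =
      (ContinuousLinearMap.pi fun (c : PBond P k) =>
          ContinuousLinearMap.proj (R := ℝ) (φ := fun _ : PBond P k => (specialUnitaryLogChart (Fin N)).lie) (c.translate v)).comp
        ((fderiv ℝ (fun (A : PBond P 0 → (specialUnitaryLogChart (Fin N)).lie) (c : PBond P k) =>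
            (isChartRep_specialUnitaryGroup (n := Fin N)).logChart
              (Averaging.iter (fun i => blockAvg (P := P) (j := i) (expMeanLogSU (n := Fin N))) k
                  (fun b => (isChartRep_specialUnitaryGroup (n := Fin N)).expChart (A b) * U₀ b) c *
                (Averaging.iter (fun i => blockAvg (P := P) (j := i) (expMeanLogSU (n := Fin N))) k U₀ c)⁻¹)) 0).comp
          (ContinuousLinearMap.pi fun (ℓ : PBond P 0) =>
            ContinuousLinearMap.proj (R := ℝ) (φ := fun _ : PBond P 0 => (specialUnitaryLogChart (Fin N)).lie) (ℓ.translate (-(Site.scaleTo k v))))) := by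
  set Ψ := fun (A : PBond P 0 → (specialUnitaryLogChart (Fin N)).lie) (c : PBond P k) =>
      (isChartRep_specialUnitaryGroup (n := Fin N)).logChart
        (Averaging.iter (fun i => blockAvg (P := P) (j := i) (expMeanLogSU (n := Fin N))) k
            (fun b => (isChartRep_specialUnitaryGroup (n := Fin N)).expChart (A b) * U₀ b) c *
          (Averaging.iter (fun i => blockAvg (P := P) (j := i) (expMeanLogSU (n := Fin N))) k U₀ c)⁻¹) with hΨ
  set T₀ : (PBond P 0 → (specialUnitaryLogChart (Fin N)).lie) →L[ℝ] (PBond P 0 → (specialUnitaryLogChart (Fin N)).lie) :=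
    ContinuousLinearMap.pi fun (ℓ : PBond P 0) =>
      ContinuousLinearMap.proj (R := ℝ) (φ := fun _ : PBond P 0 => (specialUnitaryLogChart (Fin N)).lie) (ℓ.translate (-(Site.scaleTo k v))) with hT₀
  set Tk : (PBond P k → (specialUnitaryLogChart (Fin N)).lie) →L[ℝ] (PBond P k → (specialUnitaryLogChart (Fin N)).lie) :=
    ContinuousLinearMap.pi fun (c : PBond P k) =>
      ContinuousLinearMap.proj (R := ℝ) (φ := fun _ : PBond P k => (specialUnitaryLogChart (Fin N)).lie) (c.translate v) with hTk
  -- the translated chart-read IS `Tk ∘ Ψ ∘ T₀`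
  have hfun : (fun (A : PBond P 0 → (specialUnitaryLogChart (Fin N)).lie) (c : PBond P k) =>
        (isChartRep_specialUnitaryGroup (n := Fin N)).logChart
          (Averaging.iter (fun i => blockAvg (P := P) (j := i) (expMeanLogSU (n := Fin N))) k
              (fun b => (isChartRep_specialUnitaryGroup (n := Fin N)).expChart (A b) * (U₀.translate (Site.scaleTo k v)) b) c *
            (Averaging.iter (fun i => blockAvg (P := P) (j := i) (expMeanLogSU (n := Fin N))) k (U₀.translate (Site.scaleTo k v)) c)⁻¹)) =
      (⇑Tk ∘ (Ψ ∘ ⇑T₀)) := by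
    funext A
    rw [chartRead_iter_translate]
    funext c
    simp only [Function.comp_apply, hTk, hT₀, hΨ, ContinuousLinearMap.pi_apply, ContinuousLinearMap.proj_apply]
  rw [hfun]
  -- chain rule at `0`: `T₀ 0 = 0`, `Ψ` differentiable at `0` under the guard
  have hT00 : T₀ 0 = 0 := map_zero T₀
  have hΨD : DifferentiableAt ℝ Ψ (T₀ 0) := by
    rw [hT00]
    exact (contDiffAt_chartRead_iter (P := P) (N := N) U₀ k hsb).differentiableAt (by simp)
  have h1 : HasFDerivAt (Ψ ∘ ⇑T₀) ((fderiv ℝ Ψ (T₀ 0)).comp T₀) 0 :=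
    HasFDerivAt.comp (𝕜 := ℝ) (f := ⇑T₀) (f' := T₀) (g := Ψ) (g' := fderiv ℝ Ψ (T₀ 0))
      (0 : PBond P 0 → (specialUnitaryLogChart (Fin N)).lie) hΨD.hasFDerivAt T₀.hasFDerivAt
  have h2 : HasFDerivAt (⇑Tk ∘ (Ψ ∘ ⇑T₀)) (Tk.comp ((fderiv ℝ Ψ (T₀ 0)).comp T₀)) 0 :=
    HasFDerivAt.comp (𝕜 := ℝ) (f := Ψ ∘ ⇑T₀) (f' := (fderiv ℝ Ψ (T₀ 0)).comp T₀) (g := ⇑Tk) (g' := Tk)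
      (0 : PBond P 0 → (specialUnitaryLogChart (Fin N)).lie) Tk.hasFDerivAt h1
  rw [h2.fderiv, hT00]

/-- ★★★ **TRANSLATION EQUIVARIANCE OF THE k-STEP LINEARISED CHART MAP** (px13 g29's (O2-a)): under the (0.4) guard below `k` for `U₀`, for every coarse `v : Site P k`,
`X : PBond P 0 → 𝔰𝔲(N)` and `c : PBond P k`, with `a = scaleTo k v`:
**`(fderiv ℝ Ψ_k^{τ_a U₀} 0 (fun ℓ => X (ℓ.translate a))) c = (fderiv ℝ Ψ_k^{U₀} 0 X) (c.translate v)`**.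
[cite: Balaban1985Averaging, (11) p.19, Prop. 4 (127)-(130) p.37; Balaban1987RG1, (0.11) p.253, (2.17) p.269] -/
theorem fderiv_chartRead_iter_translate (U₀ : GaugeField P 0 (SU N)) (k : ℕ)
    (hsb : SmallBelow (fun i => blockAvg (P := P) (j := i) (expMeanLogSU (n := Fin N))) k U₀) (v : Site P k)
    (X : PBond P 0 → (specialUnitaryLogChart (Fin N)).lie) (c : PBond P k) :
    fderiv ℝ (fun (A : PBond P 0 → (specialUnitaryLogChart (Fin N)).lie) (c : PBond P k) =>
        (isChartRep_specialUnitaryGroup (n := Fin N)).logChart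
          (Averaging.iter (fun i => blockAvg (P := P) (j := i) (expMeanLogSU (n := Fin N))) k
              (fun b => (isChartRep_specialUnitaryGroup (n := Fin N)).expChart (A b) * (U₀.translate (Site.scaleTo k v)) b) c *
            (Averaging.iter (fun i => blockAvg (P := P) (j := i) (expMeanLogSU (n := Fin N))) k (U₀.translate (Site.scaleTo k v)) c)⁻¹)) 0
        (fun ℓ => X (ℓ.translate (Site.scaleTo k v))) c =
      fderiv ℝ (fun (A : PBond P 0 → (specialUnitaryLogChart (Fin N)).lie) (c : PBond P k) =>
          (isChartRep_specialUnitaryGroup (n := Fin N)).logChart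
            (Averaging.iter (fun i => blockAvg (P := P) (j := i) (expMeanLogSU (n := Fin N))) k
                (fun b => (isChartRep_specialUnitaryGroup (n := Fin N)).expChart (A b) * U₀ b) c *
              (Averaging.iter (fun i => blockAvg (P := P) (j := i) (expMeanLogSU (n := Fin N))) k U₀ c)⁻¹)) 0 X (c.translate v) := by
  rw [fderiv_chartRead_iter_translate_clm (P := P) (N := N) U₀ k hsb v]
  -- `T₀ (X ∘ (·.translate a)) = X`
  have hT : (ContinuousLinearMap.pi fun (ℓ : PBond P 0) =>
            ContinuousLinearMap.proj (R := ℝ) (φ := fun _ : PBond P 0 => (specialUnitaryLogChart (Fin N)).lie) (ℓ.translate (-(Site.scaleTo k v))))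
        (fun ℓ => X (ℓ.translate (Site.scaleTo k v))) = X := by
    funext ℓ
    simp only [ContinuousLinearMap.pi_apply, ContinuousLinearMap.proj_apply, translate_neg_translate']
  rw [ContinuousLinearMap.comp_apply, ContinuousLinearMap.comp_apply, hT]
  rfl

end Summit.QuantumFields.YangMills.Theorems.FluctuationComparisonRegPrIntLS2BetaChartReadIterTranslate

end
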